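import Summits.HodgeConjecture.HodgeConjecture.Theorems.F0P2oThetaTypeJacquetLetterAOfDictionary  -- ★ p835111 A-p12 (g17): letter (a) ⟸ dictionary chart, side conditions discharged
import Summits.HodgeConjecture.HodgeConjecture.Theorems.F0P2oN3TorusWeightHolds               -- ★ p836093 A-p16 (g24): N3 ⟸ clause (a) alone (over ★ p835944 (D3d), ★ p835661∕p835430 F0P2-p06 (g3))
import HarnessLib

/-!
# Crux `H413`, programme P2, N3 road (a) — THE η-FREE (a)-ASSEMBLER: the print letter ★ N3
# `GelbartRogawski1991.thetaType_nonsplit_jacquetModule` FROM ONE LINE-JACQUET INTERTWINER («`d(1, β, 1)` acts on `r_N(ω_v)` as `ω¹(β)`»)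

Cell hodgecm-mathlib (D-0151), FLOOR 0, crux item H413 = stmt-HodgeConjecture-24833, programme P2; K1 sub-line `Cruxes/H413/Lines/F0_P2GR91NJacquetK1.lean`
(v3d: 3∕3 stubs ★, residue = the print letter N3 #96 — after ★ p836093 its CLAUSE (a) ALONE); N3 road of the K1 lead B-p18 (g29) (dealing 2026-08-31T22:04:27Z:
rows (LS)∕(FN)∕(FX)∕(LM)∕(E4)).  Seat F0P2-p06 (g4).  THEOREMS ONLY (no `def`, no instance, no notation, no named fact, no `sorry`); no `Cruxes/…/Lines` import;
kernel lane `--supports stmt-HodgeConjecture-24833 --as helper`.  HONEST LABEL: HC_CM is proved only modulo the 2 remaining named inputs (hLiu418, h413) — behind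
them the booked printed statements + the MOD package — until rung 0 closes; this file proves no letter: it REDUCES N3 to ONE intertwiner statement (N′).

THE MATHEMATICS [GelbartRogawski1991 §3.2 (3.2.1)–(3.2.3) p. 457; Kudla1986 Thm. 2.8].  `Ω := ω_v ∘ ch` is the local Weil representation of the CM package
(★ `chiLocalSplittingsCM … (toHeckeCharacter μ) … ε`, `omegaLoc v`) pulled back to `U(Φ₃)(L⁺_v)` along `ch = localLineInl ∘ localPiEquiv⁻¹ ∘ congr_T` (the reading of
★ `xThetaGqsCM`), `r_N(Ω)` its UNNORMALISED Jacquet module along `B = TN` (★ `Representation.jacquetModule`, ★ `cmBorelTriple L 3 v`); torus elements `z(β) = β·1₃`,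
`m(β) = d(β, 1, β̄⁻¹)`, `d(1, β, 1)` (`β ∈ E¹_v`), so `z(β) = m(β) · d(1, β, 1)`.  Three facts assemble clause (a) of N3 («`r_N(X_v) ≃ ℱ_v[ψθ]`»):
(i) `X_v = Ω_{U(W), χ_{f,v}}` (★ `xThetaCM` = ★ `TwistedCoinv.rep`, definitionally) and the centre `U(W) = E¹_v` acts on `Ω` through `z(β)` (★ `localLineInl_localCenter`,
★ p835430 `localPiEquiv_symm_cmDatumLocalCongr_scalar`) — so ★ A-p12 (g17)'s socket `…LetterAOfDictionary.nonempty_jacquet_xThetaGqsCM_equiv_weightSpace_of_continuous`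
(p835111 over p834861) applies at the TAUTOLOGICAL chart `S₁ := r_N(Ω)`, `π := Coinvariants.mk`, `σ := r_N(Ω) ∘ z`;
(ii) `m(β)` acts on `r_N(Ω)` by `μ_v(β)‖β‖^{1/2} = μ_v(β)` — print's (3.2.2) at `w = 0`: ★ (D3d) A-p16 (g24) p835944 (ker level) + ★ p835430 §1–§2;
(iii) **(N′) THE LINE-JACQUET INTERTWINER** — the ONE hypothesis here: `Tr : r_N(Ω) ≃ 𝒮(Fin n₀ → L⁺_v)` with `Tr ∘ r_N(Ω)(d(1, β, 1)) = ω¹(β) ∘ Tr`,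
`ω¹ = ★ lineWeilCM L e₀ (kernelLineCM dV) … μ hμ ε v` — print's (3.2.1) «`ω_ψ(diag(1, u, 1)) Φ(w) = ω_ψ^{s′}(u)(Φ(w))`» read on `r_N(ω³) ≅ ℱ` (the fibre at `w = 0`,
(3.2.3)); in the tree the target of the (N)-block (LS) local see-saw + (FN) rational-frame naturality + (LM) line matching (+ (FX)); F0P2-p01 (g8)'s «ν = 1» is (N′) at his chart.
Then `σ(β) = μ_v(β) · Tr⁻¹ ω¹(β) Tr`, i.e. «`ω¹(u) (Tr s) = μ_v(det u)⁻¹ • Tr (σ u s)`» — EXACTLY the dictionary hypothesis of ★ A-p12's socket, with NO character `η` to identify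
and no uniqueness claim — whence clause (a), and N3 by ★ p836093 `thetaType_nonsplit_jacquetModule_of_a`.

HEADS.  §1 torus∕centre bookkeeping (`glDiagonal_const_eq_scalar`, `glDiagonal_const_mem_cmLocal`, `glDiagonal_line_mem_cmLocal`, `glDiagonal_det_eq_of_fin_one`,
`glDiagonal_localDet_eq_localPiEquiv`, `exists_scalarTorusHom`, `ch_scalarTorus_eq_localCenter`); §2 `jacquetModule_omega_eq_smul_of_torusEntry_one_eq` (the `m(γ)`-weight on
`r_N(Ω)`); §3 **`nonempty_jacquet_xThetaGqsCM_equiv_weightSpace_of_lineJacquet`** (clause (a) of N3, token for token, ⟸ (N′)); §4 **`thetaType_nonsplit_jacquetModule_of_lineJacquet`**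
(N3 VERBATIM ⟸ (N′) ∀-closed over the letter's `χ_f`-free binders).

## References
* [GelbartRogawski1991] S. Gelbart, J. Rogawski, *L-functions and Fourier–Jacobi coefficients for the unitary group U(3)*, Invent. Math. 105 (1991): §3.2 (3.2.1)–(3.2.3) p. 457; §5.2 p. 467.
* [Kudla1986] S. Kudla, *On the local theta-correspondence*, Invent. Math. 83 (1986): Thm. 2.8.  [MoeglinVignerasWaldspurger1987] LNM 1291 (1987): Chap. 3 §IV.4–5.
* [BernsteinZelevinsky1977] Ann. sci. ÉNS 10 (1977): §1.8.  [Rogawski1990] Ann. of Math. Stud. 123 (1990): §1.10 p. 9; §3.13; §12.2 (2) p. 174.  [Mok2014] §1 Notation p. 5.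
* [Liu2021] Y. Liu, Camb. J. Math. 9 (2021) = arXiv:2102.11518: Def. 4.11; App. D §D.1 Step 3.
-/

set_option autoImplicit false
-- the mandated namespace has the single-problem summit's repeated segment (`HodgeConjecture.HodgeConjecture`)
set_option linter.dupNamespace false

noncomputable section

open NumberField IsDedekindDomain MeasureTheory
open scoped Matrix Kronecker

open Literature.NumberTheory Literature.NumberTheory.Automorphic Literature.NumberTheory.Automorphic.UnitaryGroup
open Literature.NumberTheory.Automorphic.IdeleClassGroup
open Literature.NumberTheory.Automorphic.Liu2021 Literature.NumberTheory.Automorphic.Liu2021.Def411WeilCarriers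
open Literature.NumberTheory.Automorphic.Liu2021.Def411WeilCarriersDoubling
open Literature.NumberTheory.GelbartRogawski1991.UnitaryDualPair Literature.NumberTheory.GelbartRogawski1991.UnitaryDualPair.WeilCoinv
open Literature.RepresentationTheory.Liu2021
open Literature.NumberTheory.GaloisRepresentations
open Literature.NumberTheory.Rogawski1990
open Literature.NumberTheory.GelbartRogawski1991
open Literature.RepresentationTheory

open Summit.HodgeConjecture.HodgeConjecture.Cruxes.H413.F0P2oN3TorusWeightOfD3d
open Summit.HodgeConjecture.HodgeConjecture.Cruxes.H413.F0P2oThetaJacquetTorusWeight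
open Summit.HodgeConjecture.HodgeConjecture.Cruxes.H413.F0P2oN3TorusWeightHolds
open Summit.HodgeConjecture.HodgeConjecture.Cruxes.H413.F0P2oThetaTypeJacquetLetterAOfDictionary

namespace Summit.HodgeConjecture.HodgeConjecture.Cruxes.H413.F0P2oN3OfLineJacquet

/-! ## §1 Torus and centre bookkeeping in `U(Φ₃)(L⁺_v)` -/

section Torus

variable (L : Type) [Field L] [NumberField L] [IsCMField L]

omit [IsCMField L] in
/-- `diag(β, β, β) = β · 1₃` as invertible matrices (★ `glDiagonal` at a constant family is Mathlib's scalar unit). [cite: Mok2014, §1 Notation p. 5] -/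
theorem glDiagonal_const_eq_scalar (v : HeightOneSpectrum (𝓞 ↥(maximalRealSubfield L))) (β : (LocalRing L v)ˣ) :
    glDiagonal 3 (LocalRing L v) (fun _ => β) =
      Units.map (Matrix.scalar (Fin 3) : LocalRing L v →+* Matrix (Fin 3) (Fin 3) (LocalRing L v)).toMonoidHom β :=
  Units.ext (by rw [coe_glDiagonal]; rfl)

/-- **The scalar `β · 1₃` (`β ∈ E¹_v`) lies in `U(Φ₃)(L⁺_v)`** (★ `scalar_mem_unitaryGroupOfForm`). [cite: Mok2014, §1 Notation p. 5] -/
theorem glDiagonal_const_mem_cmLocal (v : HeightOneSpectrum (𝓞 ↥(maximalRealSubfield L))) (β : (LocalRing L v)ˣ)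
    (hβ : conjLocal L (IsCMField.complexConj L) v (β : LocalRing L v) * β = 1) :
    glDiagonal 3 (LocalRing L v) (fun _ => β) ∈ unitaryGroupOfForm (conjLocal L (IsCMField.complexConj L) v) (cmLocalForm L 3 v) := by
  rw [glDiagonal_const_eq_scalar]
  exact scalar_mem_unitaryGroupOfForm _ _ β hβ

/-- **The line element `d(1, β, 1)` (`β ∈ E¹_v`) lies in `U(Φ₃)(L⁺_v)`** (unitarity on the antidiagonal form: `σ(d_{rev i}) d_i = 1`,
★ `glDiagonal_mem_unitaryGroupOfForm_antidiagonal_iff`). [cite: Rogawski1990, §1.10 p. 9] -/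
theorem glDiagonal_line_mem_cmLocal (v : HeightOneSpectrum (𝓞 ↥(maximalRealSubfield L))) (β : (LocalRing L v)ˣ)
    (hβ : conjLocal L (IsCMField.complexConj L) v (β : LocalRing L v) * β = 1) :
    glDiagonal 3 (LocalRing L v) ![1, β, 1] ∈ unitaryGroupOfForm (conjLocal L (IsCMField.complexConj L) v) (cmLocalForm L 3 v) := by
  rw [cmLocalForm_eq_over, glDiagonal_mem_unitaryGroupOfForm_antidiagonal_iff]
  intro i
  fin_cases i
  · show conjLocal L (IsCMField.complexConj L) v ((1 : (LocalRing L v)ˣ) : LocalRing L v) * ((1 : (LocalRing L v)ˣ) : LocalRing L v) = 1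
    rw [Units.val_one, map_one, mul_one]
  · exact hβ
  · show conjLocal L (IsCMField.complexConj L) v ((1 : (LocalRing L v)ˣ) : LocalRing L v) * ((1 : (LocalRing L v)ˣ) : LocalRing L v) = 1
    rw [Units.val_one, map_one, mul_one]

omit [IsCMField L] in
/-- **A `1 × 1` invertible matrix is `diag(det g)`.** [cite: Rogawski1990, §3.13] -/
theorem glDiagonal_det_eq_of_fin_one (v : HeightOneSpectrum (𝓞 ↥(maximalRealSubfield L))) (g : GL (Fin 1) (LocalRing L v)) :
    glDiagonal 1 (LocalRing L v) (fun _ => Matrix.GeneralLinearGroup.det g) = g := by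
  refine Units.ext (Matrix.ext fun i j => ?_)
  fin_cases i; fin_cases j
  rw [coe_glDiagonal, Matrix.diagonal_apply_eq, Matrix.GeneralLinearGroup.val_det_apply, Matrix.det_fin_one]
  rfl

/-- **A `1 × 1` unitary matrix is `(det u)`**: `localPiEquiv u = glDiagonal (det (localPiEquiv u))` in `U((ε))(L⁺_v) ≤ GL₁(∏_{w∣v} L_w)` (★ `coe_localDet`).
[cite: Rogawski1990, §3.13] -/
theorem glDiagonal_localDet_eq_localPiEquiv (v : HeightOneSpectrum (𝓞 ↥(maximalRealSubfield L))) (ε : (↥(maximalRealSubfield L))ˣ)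
    (u : localPi L (IsCMField.complexConj L) 1 (JW (↥(maximalRealSubfield L)) L ε) v)
    (hmem : glDiagonal 1 (LocalRing L v) (fun _ => ((localDet (IsCMField.complexConj L) v
        (isUnit_iff_ne_zero.mpr (by rw [Matrix.det_fin_one]; exact JW_apply_ne_zero (↥(maximalRealSubfield L)) L ε))
        (localPiEquiv L (IsCMField.complexConj L) 1 (JW (↥(maximalRealSubfield L)) L ε) v u) :
          ↥(normOneUnits (conjLocal L (IsCMField.complexConj L) v))) : (LocalRing L v)ˣ)) ∈
      «local» L (IsCMField.complexConj L) 1 (JW (↥(maximalRealSubfield L)) L ε) v) :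
    (⟨glDiagonal 1 (LocalRing L v) (fun _ => ((localDet (IsCMField.complexConj L) v
        (isUnit_iff_ne_zero.mpr (by rw [Matrix.det_fin_one]; exact JW_apply_ne_zero (↥(maximalRealSubfield L)) L ε))
        (localPiEquiv L (IsCMField.complexConj L) 1 (JW (↥(maximalRealSubfield L)) L ε) v u) :
          ↥(normOneUnits (conjLocal L (IsCMField.complexConj L) v))) : (LocalRing L v)ˣ)), hmem⟩ :
        «local» L (IsCMField.complexConj L) 1 (JW (↥(maximalRealSubfield L)) L ε) v) =
      localPiEquiv L (IsCMField.complexConj L) 1 (JW (↥(maximalRealSubfield L)) L ε) v u :=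
  Subtype.ext (glDiagonal_det_eq_of_fin_one L v _)

set_option synthInstance.maxHeartbeats 400000 in
set_option maxHeartbeats 4000000 in
/-- **The scalar torus homomorphism `z : U((ε))(L⁺_v) →* T(L⁺_v)`, `u ↦ det(u) · 1₃`** (existence with its matrix: `diag(det u, det u, det u) = z(u)`;
built from ★ `localDet`, ★ `glDiagonal` and two `codRestrict`s — the centre `E¹_v` of `U(V)(L⁺_v)` presented inside the diagonal torus of `U(Φ₃)(L⁺_v)`).
[cite: Mok2014, §1 Notation p. 5] [cite: Rogawski1990, §1.10 p. 9] -/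
theorem exists_scalarTorusHom (v : HeightOneSpectrum (𝓞 ↥(maximalRealSubfield L))) (ε : (↥(maximalRealSubfield L))ˣ) :
    ∃ z : localPi L (IsCMField.complexConj L) 1 (JW (↥(maximalRealSubfield L)) L ε) v →* ↥(cmBorelTriple L 3 v).M,
      ∀ u, glDiagonal 3 (LocalRing L v) (fun _ => ((localDet (IsCMField.complexConj L) v
        (isUnit_iff_ne_zero.mpr (by rw [Matrix.det_fin_one]; exact JW_apply_ne_zero (↥(maximalRealSubfield L)) L ε))
        (localPiEquiv L (IsCMField.complexConj L) 1 (JW (↥(maximalRealSubfield L)) L ε) v u) :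
          ↥(normOneUnits (conjLocal L (IsCMField.complexConj L) v))) : (LocalRing L v)ˣ)) =
        ((z u : ↥(unitaryGroupOfForm (conjLocal L (IsCMField.complexConj L) v) (cmLocalForm L 3 v))) : GL (Fin 3) (LocalRing L v)) := by
  let d : localPi L (IsCMField.complexConj L) 1 (JW (↥(maximalRealSubfield L)) L ε) v →* (Fin 3 → (LocalRing L v)ˣ) :=
    MonoidHom.pi fun _ => ((normOneUnits (conjLocal L (IsCMField.complexConj L) v)).subtype.comp
      ((localDet (IsCMField.complexConj L) v
        (isUnit_iff_ne_zero.mpr (by rw [Matrix.det_fin_one]; exact JW_apply_ne_zero (↥(maximalRealSubfield L)) L ε))).comp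
        (localPiEquiv L (IsCMField.complexConj L) 1 (JW (↥(maximalRealSubfield L)) L ε) v).toMulEquiv.toMonoidHom))
  have hd : ∀ u, d u = fun _ => ((localDet (IsCMField.complexConj L) v
        (isUnit_iff_ne_zero.mpr (by rw [Matrix.det_fin_one]; exact JW_apply_ne_zero (↥(maximalRealSubfield L)) L ε))
        (localPiEquiv L (IsCMField.complexConj L) 1 (JW (↥(maximalRealSubfield L)) L ε) v u) :
          ↥(normOneUnits (conjLocal L (IsCMField.complexConj L) v))) : (LocalRing L v)ˣ) := fun u => rfl
  have hmemU : ∀ u, (glDiagonal 3 (LocalRing L v)).comp d u ∈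
      unitaryGroupOfForm (conjLocal L (IsCMField.complexConj L) v) (cmLocalForm L 3 v) := fun u => by
    rw [MonoidHom.comp_apply, hd]
    exact glDiagonal_const_mem_cmLocal L v _ ((mem_normOneUnits_iff _).1 (localDet (IsCMField.complexConj L) v _
      (localPiEquiv L (IsCMField.complexConj L) 1 (JW (↥(maximalRealSubfield L)) L ε) v u)).2)
  let zU := ((glDiagonal 3 (LocalRing L v)).comp d).codRestrict _ hmemU
  have hmemT : ∀ u, zU u ∈ (cmBorelTriple L 3 v).M := fun u => (mem_torusU_iff _).2 ⟨d u, rfl⟩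
  refine ⟨zU.codRestrict _ hmemT, fun u => ?_⟩
  rw [← hd]
  rfl

set_option synthInstance.maxHeartbeats 400000 in
set_option maxHeartbeats 8000000 in
/-- **The centre through the reading `ch`**: for `z ∈ T(L⁺_v)` with matrix `det(u) · 1₃`, `ch z = localLineInl (localPiEquiv⁻¹ (T z T⁻¹))` IS the central element
`localCenter u` of the pair group `U(diag dV ⊗ (ε))(L⁺_v)` (★ p835430 `localPiEquiv_symm_cmDatumLocalCongr_scalar` + ★ `localLineInl_localCenter` + §1
`glDiagonal_localDet_eq_localPiEquiv`). [cite: Mok2014, §1 Notation p. 5] [cite: Liu2021, App. D §D.1 Step 3] -/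
theorem ch_scalarTorus_eq_localCenter (v : HeightOneSpectrum (𝓞 ↥(maximalRealSubfield L))) {n' : ℕ} (e₁ : Fin 3 × Fin 1 ≃ Fin n')
    (dV : Fin 3 → L) (ε : (↥(maximalRealSubfield L))ˣ)
    (T : GL (Fin 3) (LocalRing L v)) {a : LocalRing L v} (ha : IsUnit a)
    (h : formCongr (conjLocal L (IsCMField.complexConj L) v) T ((Matrix.diagonal dV).map (algebraMap L (LocalRing L v))) =
      a • (Matrix.of fun i j : Fin 3 => if i.val + j.val + 1 = 3 then (1 : L) else 0).map (algebraMap L (LocalRing L v)))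
    (u : localPi L (IsCMField.complexConj L) 1 (JW (↥(maximalRealSubfield L)) L ε) v) (z : Gqs L v)
    (hz : glDiagonal 3 (LocalRing L v) (fun _ => ((localDet (IsCMField.complexConj L) v
        (isUnit_iff_ne_zero.mpr (by rw [Matrix.det_fin_one]; exact JW_apply_ne_zero (↥(maximalRealSubfield L)) L ε))
        (localPiEquiv L (IsCMField.complexConj L) 1 (JW (↥(maximalRealSubfield L)) L ε) v u) :
          ↥(normOneUnits (conjLocal L (IsCMField.complexConj L) v))) : (LocalRing L v)ˣ)) = (z.val : GL (Fin 3) (LocalRing L v))) :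
    localLineInl L (IsCMField.complexConj L) 3 e₁ (Matrix.diagonal dV) (JW (↥(maximalRealSubfield L)) L ε) v
        ((localPiEquiv L (IsCMField.complexConj L) 3 (Matrix.diagonal dV) v).symm (cmDatumLocalCongr L v T ha h z)) =
      localCenter L (IsCMField.complexConj L) n' (Matrix.reindex e₁ e₁ (Matrix.diagonal dV ⊗ₖ JW (↥(maximalRealSubfield L)) L ε))
        (JW (↥(maximalRealSubfield L)) L ε) (JW_apply_ne_zero (↥(maximalRealSubfield L)) L ε) v u := by
  rw [localPiEquiv_symm_cmDatumLocalCongr_scalar L v dV ε T ha h z _ ((mem_normOneUnits_iff _).1 (localDet (IsCMField.complexConj L) v _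
      (localPiEquiv L (IsCMField.complexConj L) 1 (JW (↥(maximalRealSubfield L)) L ε) v u)).2) hz,
    localLineInl_localCenter, glDiagonal_localDet_eq_localPiEquiv L v ε u, ContinuousMulEquiv.symm_apply_apply]

end Torus

/-! ## §2 The `m(γ)`-weight on `r_N(Ω)` (print's (3.2.2) at `w = 0`, ★ (D3d) pushed to the Jacquet module) -/

section Weight

variable (L : Type) [Field L] [NumberField L] [IsCMField L]

set_option synthInstance.maxHeartbeats 400000 in
set_option maxHeartbeats 16000000 in
/-- **`m(γ) = d(γ, 1, γ̄⁻¹)` acts on `r_N(Ω)` by `μ_v(γ)‖γ‖^{1/2}`** at a non-split `v` (`t ∈ T(L⁺_v)` with `t₁₁ = 1`, `γ = t₀₀`; `Ω = ω_v ∘ ch`): ★ (D3d) p835944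
`omegaLoc_sub_smul_mem_coinvariantsKer_torus_of_nonsplit` (ker level) through ★ p835430 `jacquetModule_eq_smul_of_forall_sub_smul_mem` ∕ `coinvariantsKer_restrict_eq`.
[cite: GelbartRogawski1991, §3.2 (3.2.2) p. 457] [cite: Kudla1986, Thm. 2.8] [cite: BernsteinZelevinsky1977, §1.8] -/
theorem jacquetModule_omega_eq_smul_of_torusEntry_one_eq {n' : ℕ} (e₁ : Fin 3 × Fin 1 ≃ Fin n') (dV : Fin 3 → L)
    (hdV : ∀ i, IsCMField.complexConj L (dV i) = dV i) (hdV0 : ∀ i, dV i ≠ 0)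
    (μ : Literature.NumberTheory.Automorphic.IdeleClassGroup L →ₜ* Circle) (hμ : IsConjugateSymplectic L μ)
    (v : HeightOneSpectrum (𝓞 ↥(maximalRealSubfield L))) (hv : ∀ w : PlacesOver L v, IsCMField.complexConj L • w.1 = w.1)
    (ε : (↥(maximalRealSubfield L))ˣ)
    (T : GL (Fin 3) (UnitaryGroup.LocalRing L v)) {a : UnitaryGroup.LocalRing L v} (ha : IsUnit a)
    (h : formCongr (conjLocal L (IsCMField.complexConj L) v) T ((Matrix.diagonal dV).map (algebraMap L (UnitaryGroup.LocalRing L v))) =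
      a • (Matrix.of fun i j : Fin 3 => if i.val + j.val + 1 = 3 then (1 : L) else 0).map (algebraMap L (UnitaryGroup.LocalRing L v)))
    (t : ↥(cmBorelTriple L 3 v).M)
    (ht1 : torusEntry (conjLocal L (IsCMField.complexConj L) v) (cmLocalForm L 3 v) 1 t = 1)
    (x : ((cmBorelTriple L 3 v).restrict
      (((chiLocalSplittingsCM L e₁ dV hdV hdV0 (toHeckeCharacter L μ) ((isOscillatorChar_toHeckeCharacter_iff μ).mpr hμ) ε).omegaLoc v).comp
        ((localLineInl L (IsCMField.complexConj L) 3 e₁ (Matrix.diagonal dV) (JW (↥(maximalRealSubfield L)) L ε) v).comp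
          ((localPiEquiv L (IsCMField.complexConj L) 3 (Matrix.diagonal dV) v).symm.toMonoidHom.comp
            (cmDatumLocalCongr L v T ha h).toMonoidHom)))).Coinvariants) :
    Representation.jacquetModule
        (((chiLocalSplittingsCM L e₁ dV hdV hdV0 (toHeckeCharacter L μ) ((isOscillatorChar_toHeckeCharacter_iff μ).mpr hμ) ε).omegaLoc v).comp
          ((localLineInl L (IsCMField.complexConj L) 3 e₁ (Matrix.diagonal dV) (JW (↥(maximalRealSubfield L)) L ε) v).comp
            ((localPiEquiv L (IsCMField.complexConj L) 3 (Matrix.diagonal dV) v).symm.toMonoidHom.comp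
              (cmDatumLocalCongr L v T ha h).toMonoidHom)))
        (cmBorelTriple L 3 v) t x =
      (((toHeckeCharacter L μ).semilocalComponent L v (torusEntry (conjLocal L (IsCMField.complexConj L) v) (cmLocalForm L 3 v) 0 t) *
          halfModulusChar (UnitaryGroup.LocalRing L v) (torusEntry (conjLocal L (IsCMField.complexConj L) v) (cmLocalForm L 3 v) 0 t) : ℂˣ) : ℂ) • x := by
  refine jacquetModule_eq_smul_of_forall_sub_smul_mem _ (cmBorelTriple L 3 v) t _ (fun f => ?_) x
  rw [coinvariantsKer_restrict_eq]
  exact omegaLoc_sub_smul_mem_coinvariantsKer_torus_of_nonsplit L e₁ dV hdV hdV0 μ hμ v hv ε T ha h t ht1 f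

end Weight

/-! ## §3 Clause (a) of N3 from the line-Jacquet intertwiner (N′) -/

section ClauseA

variable (L : Type) [Field L] [NumberField L] [IsCMField L]

set_option synthInstance.maxHeartbeats 400000 in
set_option maxHeartbeats 32000000 in
/-- **CLAUSE (a) OF ★ `thetaType_nonsplit_jacquetModule` («`r_N(X_v) ≃ ℱ_v[ψθ]`», token for token) FROM ONE LINE-JACQUET INTERTWINER (N′).**  Under the letter's
binders (`Continuous χ_f`, `v` non-split, ★ `IsThetaCenterChar L μ χf ε v ψθ`, a form congruence `(T, a, h)`): IF `Tr : r_N(Ω) ≃ₗ[ℂ] 𝒮(Fin n₀ → L⁺_v)` carries the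
action of every line element `d(1, β, 1)` (`t ∈ T(L⁺_v)` with matrix `diag(1, det u, 1)`, `u ∈ U((ε))(L⁺_v)`) on the unnormalised Jacquet module `r_N(Ω)` of
`Ω = ω_v ∘ ch` to GR's `ω¹(u)` (★ `lineWeilCM L e₀ (kernelLineCM dV) … μ hμ ε v u`) — print's (3.2.1) at `w = 0` — THEN `Nonempty (r_N(X_v) ≃ₗ[ℂ] ℱ_v[ψθ])`.
Assembly: ★ A-p12 (g17) `…LetterAOfDictionary.nonempty_jacquet_xThetaGqsCM_equiv_weightSpace_of_continuous` at the tautological chart (`S₁ := r_N(Ω)`,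
`π := Coinvariants.mk`, `σ := r_N(Ω) ∘ z`), its dictionary hypothesis «`ω¹(u)(Tr s) = μ_v(det u)⁻¹ • Tr (σ u s)`» from (N′) and the `m(γ)`-weight §2 through
`z(β) = m(β) · d(1, β, 1)`, `‖β‖ = 1` (★ `halfModulusChar_eq_one_of_norm_one`).
[cite: GelbartRogawski1991, §3.2 (3.2.1)–(3.2.3) p. 457; §5.2 p. 467 L25–27] [cite: Kudla1986, Thm. 2.8] [cite: MoeglinVignerasWaldspurger1987, Chap. 3 §IV.4, §IV.5] -/
theorem nonempty_jacquet_xThetaGqsCM_equiv_weightSpace_of_lineJacquet {n' : ℕ} (e₁ : Fin 3 × Fin 1 ≃ Fin n') (dV : Fin 3 → L)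
    (hdV : ∀ i, IsCMField.complexConj L (dV i) = dV i) (hdV0 : ∀ i, dV i ≠ 0) {n₀ : ℕ} (e₀ : Fin 1 × Fin 1 ≃ Fin n₀)
    (μ : Literature.NumberTheory.Automorphic.IdeleClassGroup L →ₜ* Circle) (hμ : IsConjugateSymplectic L μ)
    (χf : UnitaryGroup.finAdelicOne (↥(maximalRealSubfield L)) L (IsCMField.complexConj L) →* ℂˣ) (ε : (↥(maximalRealSubfield L))ˣ)
    (v : HeightOneSpectrum (𝓞 ↥(maximalRealSubfield L))) (hv : ∀ w : PlacesOver L v, IsCMField.complexConj L • w.1 = w.1)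
    (hχf : Continuous χf) (ψθ : ↥(normOneUnits (conjLocal L (IsCMField.complexConj L) v)) →* ℂˣ) (hψθ : IsThetaCenterChar L μ χf ε v ψθ)
    (T : GL (Fin 3) (UnitaryGroup.LocalRing L v)) {a : UnitaryGroup.LocalRing L v} (ha : IsUnit a)
    (h : formCongr (conjLocal L (IsCMField.complexConj L) v) T ((Matrix.diagonal dV).map (algebraMap L (UnitaryGroup.LocalRing L v))) =
      a • (Matrix.of fun i j : Fin 3 => if i.val + j.val + 1 = 3 then (1 : L) else 0).map (algebraMap L (UnitaryGroup.LocalRing L v)))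
    (Tr : ((cmBorelTriple L 3 v).restrict
      (((chiLocalSplittingsCM L e₁ dV hdV hdV0 (toHeckeCharacter L μ) ((isOscillatorChar_toHeckeCharacter_iff μ).mpr hμ) ε).omegaLoc v).comp
        ((localLineInl L (IsCMField.complexConj L) 3 e₁ (Matrix.diagonal dV) (JW (↥(maximalRealSubfield L)) L ε) v).comp
          ((localPiEquiv L (IsCMField.complexConj L) 3 (Matrix.diagonal dV) v).symm.toMonoidHom.comp
            (cmDatumLocalCongr L v T ha h).toMonoidHom)))).Coinvariants ≃ₗ[ℂ]
      SchwartzBruhat (Fin n₀ → v.adicCompletion ↥(maximalRealSubfield L)))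
    (hTr : ∀ (u : localPi L (IsCMField.complexConj L) 1 (JW (↥(maximalRealSubfield L)) L ε) v) (t : ↥(cmBorelTriple L 3 v).M),
      glDiagonal 3 (LocalRing L v) ![1, ((localDet (IsCMField.complexConj L) v
        (isUnit_iff_ne_zero.mpr (by rw [Matrix.det_fin_one]; exact JW_apply_ne_zero (↥(maximalRealSubfield L)) L ε))
        (localPiEquiv L (IsCMField.complexConj L) 1 (JW (↥(maximalRealSubfield L)) L ε) v u) :
          ↥(normOneUnits (conjLocal L (IsCMField.complexConj L) v))) : (LocalRing L v)ˣ), 1] =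
        ((t : ↥(unitaryGroupOfForm (conjLocal L (IsCMField.complexConj L) v) (cmLocalForm L 3 v))) : GL (Fin 3) (LocalRing L v)) →
      ∀ x, Tr (Representation.jacquetModule
        (((chiLocalSplittingsCM L e₁ dV hdV hdV0 (toHeckeCharacter L μ) ((isOscillatorChar_toHeckeCharacter_iff μ).mpr hμ) ε).omegaLoc v).comp
          ((localLineInl L (IsCMField.complexConj L) 3 e₁ (Matrix.diagonal dV) (JW (↥(maximalRealSubfield L)) L ε) v).comp
            ((localPiEquiv L (IsCMField.complexConj L) 3 (Matrix.diagonal dV) v).symm.toMonoidHom.comp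
              (cmDatumLocalCongr L v T ha h).toMonoidHom)))
        (cmBorelTriple L 3 v) t x) =
        lineWeilCM L e₀ (kernelLineCM dV) (complexConj_kernelLineCM dV hdV) (kernelLineCM_ne_zero dV hdV0) μ hμ ε v u (Tr x)) :
    Nonempty (((cmBorelTriple L 3 v).restrict (xThetaGqsCM L e₁ dV hdV hdV0 μ hμ χf ε v T ha h)).Coinvariants ≃ₗ[ℂ]
      ↥(weightSpace (lineWeilCM L e₀ (kernelLineCM dV) (complexConj_kernelLineCM dV hdV) (kernelLineCM_ne_zero dV hdV0) μ hμ ε v) id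
        (fun u => ((ψθ (localDet (IsCMField.complexConj L) v
          (isUnit_iff_ne_zero.mpr (by rw [Matrix.det_fin_one]; exact JW_apply_ne_zero (↥(maximalRealSubfield L)) L ε))
          (localPiEquiv L (IsCMField.complexConj L) 1 (JW (↥(maximalRealSubfield L)) L ε) v u)) : ℂˣ) : ℂ)))) := by
  -- the scalar torus hom `z` and the descended centre action `σ := r_N(Ω) ∘ z` (`Ω = ω_v ∘ ch`)
  obtain ⟨z, hz⟩ := exists_scalarTorusHom L v ε
  let σ : Representation ℂ (localPi L (IsCMField.complexConj L) 1 (JW (↥(maximalRealSubfield L)) L ε) v)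
      ((cmBorelTriple L 3 v).restrict
        (((chiLocalSplittingsCM L e₁ dV hdV hdV0 (toHeckeCharacter L μ) ((isOscillatorChar_toHeckeCharacter_iff μ).mpr hμ) ε).omegaLoc v).comp
          ((localLineInl L (IsCMField.complexConj L) 3 e₁ (Matrix.diagonal dV) (JW (↥(maximalRealSubfield L)) L ε) v).comp
            ((localPiEquiv L (IsCMField.complexConj L) 3 (Matrix.diagonal dV) v).symm.toMonoidHom.comp
              (cmDatumLocalCongr L v T ha h).toMonoidHom)))).Coinvariants :=
    (Representation.jacquetModule _ (cmBorelTriple L 3 v)).comp z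
  have hβ : ∀ u : localPi L (IsCMField.complexConj L) 1 (JW (↥(maximalRealSubfield L)) L ε) v,
      conjLocal L (IsCMField.complexConj L) v (((localDet (IsCMField.complexConj L) v
        (isUnit_iff_ne_zero.mpr (by rw [Matrix.det_fin_one]; exact JW_apply_ne_zero (↥(maximalRealSubfield L)) L ε))
        (localPiEquiv L (IsCMField.complexConj L) 1 (JW (↥(maximalRealSubfield L)) L ε) v u) :
          ↥(normOneUnits (conjLocal L (IsCMField.complexConj L) v))) : (LocalRing L v)ˣ) : LocalRing L v) *
        (((localDet (IsCMField.complexConj L) v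
        (isUnit_iff_ne_zero.mpr (by rw [Matrix.det_fin_one]; exact JW_apply_ne_zero (↥(maximalRealSubfield L)) L ε))
        (localPiEquiv L (IsCMField.complexConj L) 1 (JW (↥(maximalRealSubfield L)) L ε) v u) :
          ↥(normOneUnits (conjLocal L (IsCMField.complexConj L) v))) : (LocalRing L v)ˣ) : LocalRing L v) = 1 := fun u =>
    (mem_normOneUnits_iff _).1 (localDet (IsCMField.complexConj L) v _ _).2
  -- THE DICTIONARY HYPOTHESIS «`ω¹(u)(Tr s) = μ_v(det u)⁻¹ • Tr (σ u s)`» from (N′) and the `m(γ)`-weight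
  have hdict : ∀ (u : localPi L (IsCMField.complexConj L) 1 (JW (↥(maximalRealSubfield L)) L ε) v) (s : _),
      lineWeilCM L e₀ (kernelLineCM dV) (complexConj_kernelLineCM dV hdV) (kernelLineCM_ne_zero dV hdV0) μ hμ ε v u (Tr s) =
        ((((toHeckeCharacter L μ).semilocalComponent L v
          ((localDet (IsCMField.complexConj L) v
            (isUnit_iff_ne_zero.mpr (by rw [Matrix.det_fin_one]; exact JW_apply_ne_zero (↥(maximalRealSubfield L)) L ε))
            (localPiEquiv L (IsCMField.complexConj L) 1 (JW (↥(maximalRealSubfield L)) L ε) v u) :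
              ↥(normOneUnits (conjLocal L (IsCMField.complexConj L) v))) : (UnitaryGroup.LocalRing L v)ˣ))⁻¹ : ℂˣ) : ℂ) • Tr (σ u s) := by
    intro u s
    set β : (LocalRing L v)ˣ := ((localDet (IsCMField.complexConj L) v
        (isUnit_iff_ne_zero.mpr (by rw [Matrix.det_fin_one]; exact JW_apply_ne_zero (↥(maximalRealSubfield L)) L ε))
        (localPiEquiv L (IsCMField.complexConj L) 1 (JW (↥(maximalRealSubfield L)) L ε) v u) :
          ↥(normOneUnits (conjLocal L (IsCMField.complexConj L) v))) : (LocalRing L v)ˣ)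
    obtain ⟨t, ht⟩ : ∃ t : ↥(cmBorelTriple L 3 v).M, glDiagonal 3 (LocalRing L v) ![1, β, 1] =
        ((t : ↥(unitaryGroupOfForm (conjLocal L (IsCMField.complexConj L) v) (cmLocalForm L 3 v))) : GL (Fin 3) (LocalRing L v)) :=
      ⟨⟨⟨glDiagonal 3 (LocalRing L v) ![1, β, 1], glDiagonal_line_mem_cmLocal L v β (hβ u)⟩, (mem_torusU_iff _).2 ⟨![1, β, 1], rfl⟩⟩, rfl⟩
    obtain ⟨m, hm⟩ : ∃ m : ↥(cmBorelTriple L 3 v).M, z u = m * t := ⟨z u * t⁻¹, by rw [inv_mul_cancel_right]⟩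
    have hz0 : torusEntry (conjLocal L (IsCMField.complexConj L) v) (cmLocalForm L 3 v) 0 (z u) = β := torusEntry_eq_of_glDiagonal_eq _ _ 0 (z u) _ (hz u)
    have hz1 : torusEntry (conjLocal L (IsCMField.complexConj L) v) (cmLocalForm L 3 v) 1 (z u) = β := torusEntry_eq_of_glDiagonal_eq _ _ 1 (z u) _ (hz u)
    have ht0 : torusEntry (conjLocal L (IsCMField.complexConj L) v) (cmLocalForm L 3 v) 0 t = 1 := torusEntry_eq_of_glDiagonal_eq _ _ 0 t _ ht
    have ht1 : torusEntry (conjLocal L (IsCMField.complexConj L) v) (cmLocalForm L 3 v) 1 t = β := torusEntry_eq_of_glDiagonal_eq _ _ 1 t _ ht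
    rw [hm, map_mul, ht1] at hz1
    rw [hm, map_mul, ht0, mul_one] at hz0
    have hm1 : torusEntry (conjLocal L (IsCMField.complexConj L) v) (cmLocalForm L 3 v) 1 m = 1 := mul_right_cancel (hz1.trans (one_mul β).symm)
    have hm0 : torusEntry (conjLocal L (IsCMField.complexConj L) v) (cmLocalForm L 3 v) 0 m = β := hz0
    have hσu : σ u s = Representation.jacquetModule _ (cmBorelTriple L 3 v) m
        (Representation.jacquetModule _ (cmBorelTriple L 3 v) t s) := by
      show Representation.jacquetModule _ (cmBorelTriple L 3 v) (z u) s = _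
      rw [hm, map_mul, Module.End.mul_apply]
    have hwt : Representation.jacquetModule _ (cmBorelTriple L 3 v) m (Representation.jacquetModule _ (cmBorelTriple L 3 v) t s) =
        (((toHeckeCharacter L μ).semilocalComponent L v (torusEntry (conjLocal L (IsCMField.complexConj L) v) (cmLocalForm L 3 v) 0 m) *
          halfModulusChar (UnitaryGroup.LocalRing L v) (torusEntry (conjLocal L (IsCMField.complexConj L) v) (cmLocalForm L 3 v) 0 m) : ℂˣ) : ℂ) •
          Representation.jacquetModule _ (cmBorelTriple L 3 v) t s :=
      jacquetModule_omega_eq_smul_of_torusEntry_one_eq L e₁ dV hdV hdV0 μ hμ v hv ε T ha h m hm1 _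
    have hc : (toHeckeCharacter L μ).semilocalComponent L v (torusEntry (conjLocal L (IsCMField.complexConj L) v) (cmLocalForm L 3 v) 0 m) *
        halfModulusChar (UnitaryGroup.LocalRing L v) (torusEntry (conjLocal L (IsCMField.complexConj L) v) (cmLocalForm L 3 v) 0 m) =
        (toHeckeCharacter L μ).semilocalComponent L v β := by
      rw [hm0, halfModulusChar_eq_one_of_norm_one L v β (hβ u), mul_one]
    have key : Tr (σ u s) = (((toHeckeCharacter L μ).semilocalComponent L v β : ℂˣ) : ℂ) •
        lineWeilCM L e₀ (kernelLineCM dV) (complexConj_kernelLineCM dV hdV) (kernelLineCM_ne_zero dV hdV0) μ hμ ε v u (Tr s) :=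
      (congrArg Tr hσu).trans ((congrArg Tr hwt).trans ((map_smul Tr _ _).trans
        ((congrArg (fun c : ℂˣ => (c : ℂ) • Tr (Representation.jacquetModule _ (cmBorelTriple L 3 v) t s)) hc).trans
          (congrArg _ (hTr u t ht s)))))
    rw [key, smul_smul, ← Units.val_mul, inv_mul_cancel, Units.val_one, one_smul]
  -- feed ★ A-p12's socket at the tautological chart
  refine nonempty_jacquet_xThetaGqsCM_equiv_weightSpace_of_continuous L e₁ dV hdV hdV0 e₀ μ hμ χf ε v hv hχf ψθ hψθ T ha h
    (Representation.Coinvariants.mk ((cmBorelTriple L 3 v).restrict _)) (Representation.Coinvariants.mk_surjective _) ?_ σ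
    (fun u f => ?_) Tr hdict
  · -- `ker (Coinvariants.mk) = Coinvariants.ker (Ω|_N)`
    exact (Submodule.ker_mkQ _).trans (coinvariantsKer_restrict_eq _ (cmBorelTriple L 3 v))
  · -- the centre acts through `z`: `[ω_v(localCenter u) f] = σ u [f] = [Ω (z u) f]` (★ `jacquetModule_mk` is `rfl`)
    exact congrArg (fun g => Representation.Coinvariants.mk _
      ((chiLocalSplittingsCM L e₁ dV hdV hdV0 (toHeckeCharacter L μ) ((isOscillatorChar_toHeckeCharacter_iff μ).mpr hμ) ε).omegaLoc v g f))
      (ch_scalarTorus_eq_localCenter L v e₁ dV ε T ha h u _ (hz u)).symm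

end ClauseA

/-! ## §4 N3 — ★ `GelbartRogawski1991.thetaType_nonsplit_jacquetModule` — from (N′) alone -/

set_option synthInstance.maxHeartbeats 400000 in
set_option maxHeartbeats 32000000 in
/-- **N3 FROM THE LINE-JACQUET INTERTWINER (N′), ∀-closed over the letter's `χ_f`-free binders** (`L, e₁, dV, e₀, μ, v` non-split, `ε, T, a, h`): the print letter
★ `GelbartRogawski1991.thetaType_nonsplit_jacquetModule` VERBATIM — clause (a) by §3, clause (b) and the packaging by ★ p836093 `thetaType_nonsplit_jacquetModule_of_a`
(over ★ p835944 (D3d), ★ p835661 packager, ★ p835430 (b)-assembler).  What remains for N3 after this file = EXACTLY `hL`: print's (3.2.1) «`ω_ψ(diag(1,u,1))Φ(w) =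
ω_ψ^{s′}(u)(Φ(w))`» on `r_N(ω³) ≅ ℱ` [GelbartRogawski1991 §3.2 p. 457; Kudla1986 Thm. 2.8] — the (N)-block (LS)+(FN)+(LM)(+(FX)) of the K1 lead's dealing.
[cite: GelbartRogawski1991, §3.2 (3.2.1)–(3.2.3) p. 457; §5.2 p. 467] [cite: Kudla1986, Thm. 2.8] [cite: Rogawski1990, §12.2 (2) p. 174] -/
theorem thetaType_nonsplit_jacquetModule_of_lineJacquet
    (hL : ∀ (L : Type) [Field L] [NumberField L] [IsCMField L]
      {n' : ℕ} (e₁ : Fin 3 × Fin 1 ≃ Fin n') (dV : Fin 3 → L) (hdV : ∀ i, IsCMField.complexConj L (dV i) = dV i) (hdV0 : ∀ i, dV i ≠ 0)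
      {n₀ : ℕ} (e₀ : Fin 1 × Fin 1 ≃ Fin n₀)
      (μ : Literature.NumberTheory.Automorphic.IdeleClassGroup L →ₜ* Circle) (hμ : IsConjugateSymplectic L μ)
      (v : HeightOneSpectrum (𝓞 ↥(maximalRealSubfield L))),
        (∀ w : PlacesOver L v, IsCMField.complexConj L • w.1 = w.1) →
        ∀ (ε : (↥(maximalRealSubfield L))ˣ)
          (T : GL (Fin 3) (UnitaryGroup.LocalRing L v)) (a : UnitaryGroup.LocalRing L v) (ha : IsUnit a)
          (h : formCongr (conjLocal L (IsCMField.complexConj L) v) T ((Matrix.diagonal dV).map (algebraMap L (UnitaryGroup.LocalRing L v))) =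
            a • (Matrix.of fun i j : Fin 3 => if i.val + j.val + 1 = 3 then (1 : L) else 0).map (algebraMap L (UnitaryGroup.LocalRing L v))),
          ∃ Tr : ((cmBorelTriple L 3 v).restrict
            (((chiLocalSplittingsCM L e₁ dV hdV hdV0 (toHeckeCharacter L μ) ((isOscillatorChar_toHeckeCharacter_iff μ).mpr hμ) ε).omegaLoc v).comp
              ((localLineInl L (IsCMField.complexConj L) 3 e₁ (Matrix.diagonal dV) (JW (↥(maximalRealSubfield L)) L ε) v).comp
                ((localPiEquiv L (IsCMField.complexConj L) 3 (Matrix.diagonal dV) v).symm.toMonoidHom.comp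
                  (cmDatumLocalCongr L v T ha h).toMonoidHom)))).Coinvariants ≃ₗ[ℂ]
            SchwartzBruhat (Fin n₀ → v.adicCompletion ↥(maximalRealSubfield L)),
          ∀ (u : localPi L (IsCMField.complexConj L) 1 (JW (↥(maximalRealSubfield L)) L ε) v) (t : ↥(cmBorelTriple L 3 v).M),
            glDiagonal 3 (LocalRing L v) ![1, ((localDet (IsCMField.complexConj L) v
              (isUnit_iff_ne_zero.mpr (by rw [Matrix.det_fin_one]; exact JW_apply_ne_zero (↥(maximalRealSubfield L)) L ε))
              (localPiEquiv L (IsCMField.complexConj L) 1 (JW (↥(maximalRealSubfield L)) L ε) v u) :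
                ↥(normOneUnits (conjLocal L (IsCMField.complexConj L) v))) : (LocalRing L v)ˣ), 1] =
              ((t : ↥(unitaryGroupOfForm (conjLocal L (IsCMField.complexConj L) v) (cmLocalForm L 3 v))) : GL (Fin 3) (LocalRing L v)) →
            ∀ x, Tr (Representation.jacquetModule
              (((chiLocalSplittingsCM L e₁ dV hdV hdV0 (toHeckeCharacter L μ) ((isOscillatorChar_toHeckeCharacter_iff μ).mpr hμ) ε).omegaLoc v).comp
                ((localLineInl L (IsCMField.complexConj L) 3 e₁ (Matrix.diagonal dV) (JW (↥(maximalRealSubfield L)) L ε) v).comp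
                  ((localPiEquiv L (IsCMField.complexConj L) 3 (Matrix.diagonal dV) v).symm.toMonoidHom.comp
                    (cmDatumLocalCongr L v T ha h).toMonoidHom)))
              (cmBorelTriple L 3 v) t x) =
              lineWeilCM L e₀ (kernelLineCM dV) (complexConj_kernelLineCM dV hdV) (kernelLineCM_ne_zero dV hdV0) μ hμ ε v u (Tr x)) :
    Literature.NumberTheory.GelbartRogawski1991.thetaType_nonsplit_jacquetModule := by
  refine thetaType_nonsplit_jacquetModule_of_a fun L _ _ _ n' e₁ dV hdV hdV0 n₀ e₀ μ hμ χf hc _ v hv ε ψθ hθ T a ha h => ?_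
  obtain ⟨Tr, hTr⟩ := hL L e₁ dV hdV hdV0 e₀ μ hμ v hv ε T a ha h
  exact nonempty_jacquet_xThetaGqsCM_equiv_weightSpace_of_lineJacquet L e₁ dV hdV hdV0 e₀ μ hμ χf ε v hv hc ψθ hθ T ha h Tr hTr

end Summit.HodgeConjecture.HodgeConjecture.Cruxes.H413.F0P2oN3OfLineJacquet

end
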